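import Summits.BirchSwinnertonDyer.BirchSwinnertonDyer.Theorems.PrintCf2SplitBadTwoCMPrimaryDyadicTableRelaxed
import Summits.BirchSwinnertonDyer.BirchSwinnertonDyer.Theorems.PrintCf2SplitBadTwoLocalControlKernelGood
import Summits.BirchSwinnertonDyer.BirchSwinnertonDyer.Theorems.SchneiderFreeAdditiveX3LocalTowerTorsionFiniteOfLine
import Summits.Ventures.HodgeRepro2.T5DegreeOneNumberField
import Literature.NumberTheory.GaloisCohomology.Howard2004.FiniteSingularTame
import Literature.NumberTheory.QuadraticFields.KroneckerSplitting
import HarnessLib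

/-!
# Crux `PrintCf2.SplitBadTwoRankOneOfFacts` (stmt-BirchSwinnertonDyer-20368), road α v10.3 — brick B15 file 7: THE DYADIC TABLE AT THE STRICT PLACE —
# `#W*(K_{v̄}) = 4` for `d ≡ 3 (mod 8)` (with file 4: `= 2` otherwise), completing the dyadic local factors of Agboola §6 / Prop. 8.1 on the class

Cell `bsd-print-cf2`, width seat `bsd-line-cf2-p1-w2` g9 (prover-bsd-line-cf2-p1-w2-g9-0); brick B15 (memo
`Cruxes/SplitBadTwoRankOneOfFacts/B15-DYADIC-EXACT-w2g9.md` §3, row (1,3)); `--supports stmt-BirchSwinnertonDyer-20368` (helper, Theses-free). HONEST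
FRAMING: nothing here closes the crux or a registered stub; BSD is not proved by any of this; no summit statement is proved by this seat. No definition,
no named fact, no `sorry`. Sequel of files 3–6.

WHAT. S3c frame: `C • W = cm7^{(d)}` (`d ≠ 0`, here `d ≡ 3 (mod 8)`), `K` imaginary quadratic, `v̄ ≠ v` above `2`, `π² = π − 2` in `End_K(E_K)`, `r² = r − 2`,
pinning clause at `v` for `W* := E[𝔮_r^∞]` (kernel type (R) at `v̄`).
* §1 `residueFieldCard_adicCompletion_eq_two_of_frame` — `#𝓀(K_w) = 2` at `w ∣ 2` on the frame (`d_K = −7 ≡ 1 (8)`: `2` splits, `e·f = 1`; tree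
  `ramificationIdx_mul_inertiaDeg_eq_one_of_splitsIn`, `natCard_quot_pow'`, `residueFieldCard_adicCompletion_eq_natCard`).
* §2 **`smul_eq_self_of_mem_decomp_vbar_of_frame`** — for `d ≡ 3 (8)` EVERY `δ ∈ D_{v̄}` fixes `W*[4]`: the stabiliser of a generator of `W*[4]` is an open
  subgroup of `D_{v̄}` containing the inertia group (sign `+1` on `√(−d)`, file 5 (U1), so the (R)-fixer of file 6 applies with `n = 0`) and a
  degree-`1` element (sign `−1` on `√(−d)`, file 5 (U2), `n = 1`), hence everything (-w3's `exists_frobPow_generator_decomp`, p658559).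
  **`natCard_fixedPoints_decomp_vbar_eq_four_of_frame`** — `#W*(K_{v̄}) = #H⁰(K_{v̄}, W*) = 4` EXACTLY for `d ≡ 3 (8)`.
So on the class (with p662192, p663559-series): `#W*(K_v) = 2` always, `#W*(K_{v̄}) = 4` iff `d ≡ 3 (8)` else `2` — EXACT functions of `[d]₂` (S3c key
`(d % 2, d' % 8)`: value `4` exactly on key `(1,3)`). presearch: Rubin LNM 1716 §3 Lemma 3.6 (ii), Cor. 3.17; Agboola 2007 §6 / Prop. 8.1; Neukirch II
(7.13), (9.9) — held; no fact filed. beyond-print theorem: no.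

References: [Rubin1999] §3 Lemma 3.6 (ii), Cor. 3.17; [Agboola2007] §6, Prop. 8.1; [NeukirchANT1999] Ch. II (7.13), (9.9).
-/

noncomputable section

open scoped Classical

set_option linter.dupNamespace false
set_option autoImplicit false

namespace Summit.BirchSwinnertonDyer.BirchSwinnertonDyer.Theorems.PrintCf2.CMPrimes

open WeierstrassCurve Literature.NumberTheory.EllipticCurves Literature.NumberTheory.GaloisRepresentations Field NumberField
  IsDedekindDomain
open Summit.BirchSwinnertonDyer.BirchSwinnertonDyer.Theorems.PrintCf2.AdditiveAtSeven
open Summit.BirchSwinnertonDyer.BirchSwinnertonDyer.Theorems.PrintCf2.ReductionTypesOverK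
open Summit.BirchSwinnertonDyer.BirchSwinnertonDyer.Theorems.PrintCf2.RestrictedSelmerPair
open Summit.BirchSwinnertonDyer.BirchSwinnertonDyer.Theorems.SchneiderFreeAdditiveX3 (liesOver_span_of_natCast_mem
  ramificationIdx_mul_inertiaDeg_eq_one_of_splitsIn)
open Summit.Ventures.HodgeRepro2.T5DegreeOneNumberField (natCard_quot_pow')
open Literature.NumberTheory.GaloisCohomology.Howard2004 (residueFieldCard_adicCompletion_eq_natCard)
open Literature.NumberTheory.GaloisRepresentations.IsNonarchimedeanLocalField

variable {K : Type} [Field K] [NumberField K]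

/-! ## §1. `#𝓀(K_w) = 2` at the places above `2` on the frame -/

/-- **`#𝓀(K_w) = 2` at `w ∣ 2` on the frame** (`K` imaginary quadratic with `θ² = −7`, so `d_K = −7 ≡ 1 (mod 8)` and `2` splits: `e(w|2)·f(w|2) = 1`,
`#(𝓞_K/w) = 2`). [cite: NeukirchANT1999, Ch. I §8 Prop. (8.3)] -/
theorem residueFieldCard_adicCompletion_eq_two_of_frame {d : ℤ} (hd0 : d ≠ 0) (W : WeierstrassCurve ℚ) [W.IsElliptic]
    {C : VariableChange ℚ} (hC : C • W = cm7.quadraticTwist (d : ℚ)) (hK : IsImaginaryQuadratic K) {θ : K} (hθ : θ ^ 2 = -7)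
    {w : HeightOneSpectrum (𝓞 K)} (hw : ((2 : ℕ) : 𝓞 K) ∈ w.asIdeal) :
    residueFieldCard (w.adicCompletion K) = 2 := by
  haveI : Fact (Nat.Prime 2) := ⟨Nat.prime_two⟩
  have hdK := discr_eq_neg_seven_of_sq_eq K hK hθ hd0 W hC
  have hs : Summit.BirchSwinnertonDyer.Rank1Residual.X11b.SplitsIn K 2 := by
    unfold Summit.BirchSwinnertonDyer.Rank1Residual.X11b.SplitsIn
    rw [Nat.cast_ofNat, Literature.NumberTheory.QuadraticFields.Quadratic.ncard_primesOver_two_eq_two_iff hK.1, hdK]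
    decide
  haveI := liesOver_span_of_natCast_mem (K := K) hw
  have hdeg := ramificationIdx_mul_inertiaDeg_eq_one_of_splitsIn hK.1 hs hw
  have hcard := natCard_quot_pow' w 2 hdeg 1
  rw [pow_one, pow_one] at hcard
  rw [residueFieldCard_adicCompletion_eq_natCard, hcard]

/-! ## §2. `d ≡ 3 (mod 8)`: every `δ ∈ D_{v̄}` fixes `W*[4]`, so `#W*(K_{v̄}) = 4` -/

/-- **For `d ≡ 3 (mod 8)`, EVERY `δ ∈ D_{v̄}` FIXES `W*[4]`** (`W* = E[𝔮_r^∞]` pinned at `v`, kernel type at `v̄`): the stabiliser in `D_{v̄}` of a generator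
of `W*[4]` is open and contains the inertia group (`τ ∈ I`: sign `+1` on `√(−d)` by file 5 (U1), so the (R)-fixer applies with `n = 0`) and a degree-`1`
element (sign `−1` on `√(−d)` by file 5 (U2), `n = 1`), hence is everything (`exists_frobPow_generator_decomp`).
[cite: Rubin1999, §3 Lemma 3.6 (ii) and Cor. 3.17] [cite: NeukirchANT1999, Ch. II §9 Prop. (9.9)] -/
theorem smul_eq_self_of_mem_decomp_vbar_of_frame {d : ℤ} (hd0 : d ≠ 0) (hd8 : d % 8 = 3)
    (W : WeierstrassCurve ℚ) [W.IsElliptic] (C : VariableChange ℚ) (hC : C • W = cm7.quadraticTwist (d : ℚ)) (hK : IsImaginaryQuadratic K)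
    (v vbar : HeightOneSpectrum (𝓞 K)) (hv : ((2 : ℕ) : 𝓞 K) ∈ v.asIdeal) (hvbar : ((2 : ℕ) : 𝓞 K) ∈ vbar.asIdeal) (hne : vbar ≠ v)
    (π : (W.baseChange K).endRing) (hrel : (π : AddMonoid.End (W.baseChange K).geomPoints) * π = π - 2) {r : ℤ_[2]} (hr : r * r = r - 2)
    (hclause : ∀ τ ∈ GreenbergSelmer.inertia v, ∀ x : ↥((W.baseChange K).endEigenPrimaryTorsion 2 π r), τ • x = x ∨ τ • x = -x)
    {x : (W.baseChange K).geomPrimaryTorsion 2} (hx : x ∈ (W.baseChange K).endEigenPrimaryTorsion 2 π r) (hx4 : 4 • x = 0)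
    {δ : absoluteGaloisGroup K} (hδ : δ ∈ GreenbergSelmer.decomp vbar) : δ • x = x := by
  haveI : Fact (Nat.Prime 2) := ⟨Nat.prime_two⟩
  have hj : W.j = -3375 := j_eq_of_smul_eq_cm7Twist hd0 W C hC
  obtain ⟨θ, hθ⟩ := exists_sq_eq_neg_seven_of_cmEndo_mem_endRing W K hj π hrel
  have hK2 : Module.finrank ℚ K = 2 := hK.1
  -- the kernel-type clause (R) at `v̄` for `E[𝔮_r^∞]`
  obtain ⟨hcl', -⟩ := endEigenPrimaryTorsion_two_pinningClause_swap W K hj hK hθ π hrel hr hv hvbar hne hclause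
  have hcl'' : ∀ τ ∈ GreenbergSelmer.inertia vbar, ∀ y ∈ (W.baseChange K).endEigenPrimaryTorsion 2 π (1 - r),
      τ • y = y ∨ τ • y = -y := fun τ hτ y hy ↦ by
    rcases hcl' τ hτ ⟨y, hy⟩ with h | h
    · exact Or.inl (congrArg Subtype.val h)
    · exact Or.inr (congrArg Subtype.val h)
  have h1r : (1 - r) * (1 - r) = (1 - r) - 2 := by linear_combination hr
  have hdQ : (d : ℚ) ≠ 0 := by exact_mod_cast hd0
  obtain ⟨α, hα, -, hUR⟩ := endEigenPrimaryTorsion_two_localTypes_named_of_pinned W K hj hθ π hrel h1r hdQ C hC vbar hvbar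
    (inertiaDeg_eq_one_of_ne_two K hK2 hvbar hv hne.symm) hcl''
  simp only [sub_sub_cancel] at hUR
  have HR := fun σ n hσ s hs ↦ (hUR σ n hσ s hs).2
  have hq := residueFieldCard_adicCompletion_eq_two_of_frame hd0 W hC hK hθ hvbar
  have hm4 : (-d) % 4 = 1 := by omega
  have hm8 : (-d) % 8 = 5 := by omega
  -- the fixer, for an element of degree `n ∈ {0, 1}` acting on `√(−d)` by `(−1)ⁿ`
  have hfix : ∀ (σ : absoluteGaloisGroup (vbar.adicCompletion K)) (n : ℕ), IsFrobPow σ (n : ℤ) →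
      ((absGaloisRestrict K (vbar.adicCompletion K) σ • WeierstrassCurve.geomSqrt ((-d : ℤ) : K) =
          WeierstrassCurve.geomSqrt ((-d : ℤ) : K) ∧ ((-1 : ℤ) ^ n = 1)) ∨
       (absGaloisRestrict K (vbar.adicCompletion K) σ • WeierstrassCurve.geomSqrt ((-d : ℤ) : K) =
          -WeierstrassCurve.geomSqrt ((-d : ℤ) : K) ∧ ((-1 : ℤ) ^ n = -1))) →
      absGaloisRestrict K (vbar.adicCompletion K) σ • x = x := by
    intro σ n hσ hB
    set g := absGaloisRestrict K (vbar.adicCompletion K) σ with hg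
    rcases smul_absClosureEmbedding_geomSqrt_eq_or K (d : ℚ) g with hA | hA <;>
      rcases smul_absClosureEmbedding_geomSqrt_eq_or K (-1 : ℚ) g with hZ | hZ
    · rcases hB with ⟨hB, hn⟩ | ⟨hB, hn⟩
      · exact smul_eq_of_kernelType K W hα HR hσ (s := 1) (e := 1) (Or.inl ⟨hA, rfl⟩) (Or.inl ⟨hZ, rfl⟩) (by rw [hn]; norm_num) hx hx4
      · have hse := sign_mul_eq_of_smul_geomSqrt K hd0 g (s := 1) (e := 1) (Or.inl ⟨hA, rfl⟩) (Or.inl ⟨hZ, rfl⟩) (Or.inr ⟨hB, rfl⟩)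
        norm_num at hse
    · rcases hB with ⟨hB, hn⟩ | ⟨hB, hn⟩
      · have hse := sign_mul_eq_of_smul_geomSqrt K hd0 g (s := 1) (e := -1) (Or.inl ⟨hA, rfl⟩) (Or.inr ⟨hZ, rfl⟩) (Or.inl ⟨hB, rfl⟩)
        norm_num at hse
      · exact smul_eq_of_kernelType K W hα HR hσ (s := 1) (e := -1) (Or.inl ⟨hA, rfl⟩) (Or.inr ⟨hZ, rfl⟩) (by rw [hn]; norm_num) hx hx4
    · rcases hB with ⟨hB, hn⟩ | ⟨hB, hn⟩
      · have hse := sign_mul_eq_of_smul_geomSqrt K hd0 g (s := -1) (e := 1) (Or.inr ⟨hA, rfl⟩) (Or.inl ⟨hZ, rfl⟩) (Or.inl ⟨hB, rfl⟩)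
        norm_num at hse
      · exact smul_eq_of_kernelType K W hα HR hσ (s := -1) (e := 1) (Or.inr ⟨hA, rfl⟩) (Or.inl ⟨hZ, rfl⟩) (by rw [hn]; norm_num) hx hx4
    · rcases hB with ⟨hB, hn⟩ | ⟨hB, hn⟩
      · exact smul_eq_of_kernelType K W hα HR hσ (s := -1) (e := -1) (Or.inr ⟨hA, rfl⟩) (Or.inr ⟨hZ, rfl⟩) (by rw [hn]; norm_num) hx hx4
      · have hse := sign_mul_eq_of_smul_geomSqrt K hd0 g (s := -1) (e := -1) (Or.inr ⟨hA, rfl⟩) (Or.inr ⟨hZ, rfl⟩) (Or.inr ⟨hB, rfl⟩)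
        norm_num at hse
  -- generation of `D_{v̄}` by inertia and one degree-`1` element
  obtain ⟨φ, hφ1, hF, hgenU⟩ := exists_frobPow_generator_decomp vbar (D := GreenbergSelmer.decomp vbar) le_rfl le_rfl
  let xm : ↥((W.baseChange K).endEigenPrimaryTorsion 2 π r) := ⟨x, hx⟩
  let U : Subgroup ↥(GreenbergSelmer.decomp vbar) := MulAction.stabilizer ↥(GreenbergSelmer.decomp vbar) xm
  have hU : IsOpen (U : Set ↥(GreenbergSelmer.decomp vbar)) := by
    have hcont : Continuous fun g : ↥(GreenbergSelmer.decomp vbar) ↦ g • xm :=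
      (continuous_smul_endEigenPrimaryTorsion (W.baseChange K) 2 π r xm).comp continuous_subtype_val
    have : (U : Set ↥(GreenbergSelmer.decomp vbar)) = (fun g : ↥(GreenbergSelmer.decomp vbar) ↦ g • xm) ⁻¹' {xm} := by
      ext g; exact MulAction.mem_stabilizer_iff
    rw [this]
    exact hcont.isOpen_preimage _ (isOpen_discrete _)
  have hIU : (GreenbergSelmer.inertia vbar).subgroupOf (GreenbergSelmer.decomp vbar) ≤ U := by
    intro g hg
    rw [Subgroup.mem_subgroupOf] at hg
    obtain ⟨τ, hτI, hτg⟩ := Subgroup.mem_map.mp hg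
    rw [MulAction.mem_stabilizer_iff]
    apply Subtype.ext
    change ((g : absoluteGaloisGroup K) • xm : ↥((W.baseChange K).endEigenPrimaryTorsion 2 π r)).1 = x
    have hτ0 : IsFrobPow τ ((0 : ℕ) : ℤ) := by exact_mod_cast isFrobPow_zero_iff_mem_absInertia.mpr hτI
    have hB := smul_geomSqrt_eq_of_mem_absInertia_of_emod_four_eq_one vbar hvbar hm4 hτI
    have h := hfix τ 0 hτ0 (Or.inl ⟨hB, by norm_num⟩)
    rw [← hτg]
    exact h
  have hFU : (⟨absGaloisRestrict K (vbar.adicCompletion K) φ, hF⟩ : ↥(GreenbergSelmer.decomp vbar)) ∈ U := by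
    rw [MulAction.mem_stabilizer_iff]
    apply Subtype.ext
    change (absGaloisRestrict K (vbar.adicCompletion K) φ • xm : ↥((W.baseChange K).endEigenPrimaryTorsion 2 π r)).1 = x
    have hφ1' : IsFrobPow φ ((1 : ℕ) : ℤ) := by exact_mod_cast hφ1
    have hB := smul_geomSqrt_eq_neg_of_isFrobPow_one_of_emod_eight_eq_five vbar hvbar hq hm8 hφ1
    exact hfix φ 1 hφ1' (Or.inr ⟨hB, by norm_num⟩)
  have htop := hgenU U hU hIU hFU
  have hδU : (⟨δ, hδ⟩ : ↥(GreenbergSelmer.decomp vbar)) ∈ U := htop ▸ Subgroup.mem_top _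
  rw [MulAction.mem_stabilizer_iff] at hδU
  exact congrArg Subtype.val hδU

/-- **THE EXACT DYADIC VALUE `#W*(K_{v̄}) = 4` FOR `d ≡ 3 (mod 8)`** on every S3c frame (member `C • W = cm7^{(d)}`, `K` imaginary quadratic, `v̄ ≠ v` above
`2`, `π² = π − 2` in `End_K(E_K)`, `r² = r − 2`, pinning clause at `v`): the `D_{v̄}`-fixed subgroup of `W* = E[𝔮_r^∞]` is `W*[4]` — it contains `W*[4]`
(`smul_eq_self_of_mem_decomp_vbar_of_frame`) and has `2` or `4` elements (p656168). With p662192 (`= 2` for `d ≢ 3 (8)`) the dyadic factor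
`#W*(K_{v̄})` of Agboola §6 / Prop. 8.1 is an exact function of `[d]₂`. [cite: Agboola2007, §6 and Prop. 8.1] [cite: Rubin1999, §3 Cor. 3.17] -/
theorem natCard_fixedPoints_decomp_vbar_eq_four_of_frame {d : ℤ} (hd0 : d ≠ 0) (hd8 : d % 8 = 3)
    (W : WeierstrassCurve ℚ) [W.IsElliptic] (C : VariableChange ℚ) (hC : C • W = cm7.quadraticTwist (d : ℚ)) (hK : IsImaginaryQuadratic K)
    (v vbar : HeightOneSpectrum (𝓞 K)) (hv : ((2 : ℕ) : 𝓞 K) ∈ v.asIdeal) (hvbar : ((2 : ℕ) : 𝓞 K) ∈ vbar.asIdeal) (hne : vbar ≠ v)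
    (π : (W.baseChange K).endRing) (hrel : (π : AddMonoid.End (W.baseChange K).geomPoints) * π = π - 2) {r : ℤ_[2]} (hr : r * r = r - 2)
    (hclause : ∀ τ ∈ GreenbergSelmer.inertia v, ∀ x : ↥((W.baseChange K).endEigenPrimaryTorsion 2 π r), τ • x = x ∨ τ • x = -x) :
    Nat.card (FixedPoints.addSubgroup (GreenbergSelmer.decomp vbar) ↥((W.baseChange K).endEigenPrimaryTorsion 2 π r)) = 4 := by
  haveI : Fact (Nat.Prime 2) := ⟨Nat.prime_two⟩
  have hj : W.j = -3375 := j_eq_of_smul_eq_cm7Twist hd0 W C hC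
  obtain ⟨θ, hθ⟩ := exists_sq_eq_neg_seven_of_cmEndo_mem_endRing W K hj π hrel
  have hK2 : Module.finrank ℚ K = 2 := hK.1
  set M := (W.baseChange K).endEigenPrimaryTorsion 2 π r with hM_def
  obtain ⟨-, -, -, -, -, hcard, -, -⟩ := endEigenPrimaryTorsion_two_structure W hj K hθ π hrel hr
  -- the fixed subgroup in the ambient group: `2` or `4` elements
  let F : AddSubgroup ((W.baseChange K).geomPrimaryTorsion 2) := (FixedPoints.addSubgroup (GreenbergSelmer.decomp vbar) ↥M).map M.subtype
  have hFle : F ≤ M := by rintro _ ⟨y, -, rfl⟩; exact y.2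
  have hF2 : ∀ y ∈ M, 2 • y = 0 → y ∈ F := by
    intro y hy h2
    refine ⟨⟨y, hy⟩, ?_, rfl⟩
    rw [SetLike.mem_coe, FixedPoints.mem_addSubgroup]
    rintro ⟨δ, hδ⟩
    exact Subtype.ext (smul_eq_self_of_two_nsmul_eq_zero W K hj hθ π hrel hr δ y hy h2)
  have hFfix : ∀ δ ∈ GreenbergSelmer.decomp vbar, ∀ y ∈ F, δ • y = y := by
    rintro δ hδ _ ⟨y, hy, rfl⟩
    rw [SetLike.mem_coe, FixedPoints.mem_addSubgroup] at hy
    exact congrArg Subtype.val (hy ⟨δ, hδ⟩)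
  have hcardF : Nat.card F = Nat.card (FixedPoints.addSubgroup (GreenbergSelmer.decomp vbar) ↥M) :=
    (Nat.card_congr (AddSubgroup.equivMapOfInjective _ M.subtype Subtype.val_injective).toEquiv).symm
  rw [← hcardF]
  rcases natCard_eq_two_or_four_of_fixed W K hj hK2 hθ π hrel hr hvbar hv hne.symm F hFle hF2 hFfix with h2 | h4
  swap
  · exact h4
  · exfalso
    -- `W*[4] ≤ F` has `4` elements
    haveI : Finite ↥F := Nat.finite_of_card_ne_zero (by rw [h2]; norm_num)
    have hle : M ⊓ AddSubgroup.torsionBy ((W.baseChange K).geomPrimaryTorsion 2) (2 ^ 2 : ℕ) ≤ F := by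
      rintro y ⟨hy, hy4⟩
      have hy4' : 4 • y = 0 := by simpa using AddSubgroup.torsionBy.nsmul_iff.mp hy4
      refine ⟨⟨y, hy⟩, ?_, rfl⟩
      rw [SetLike.mem_coe, FixedPoints.mem_addSubgroup]
      rintro ⟨δ, hδ⟩
      exact Subtype.ext (smul_eq_self_of_mem_decomp_vbar_of_frame hd0 hd8 W C hC hK v vbar hv hvbar hne π hrel hr hclause hy hy4' hδ)
    have h := Nat.card_le_card_of_injective _ (AddSubgroup.inclusion_injective hle)
    rw [hcard 2, h2] at h
    norm_num at h

end Summit.BirchSwinnertonDyer.BirchSwinnertonDyer.Theorems.PrintCf2.CMPrimes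

end
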